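import Summits.CriticalPhenomena.PercolationContinuityZ3.Theorems.PercNearOneGluingNoHeavyLowerTailKnQuestion8CoefficientwiseTwoSourceDomination
import Summits.CriticalPhenomena.PercolationContinuityZ3.Theorems.PercNearOneGluingNoHeavyLowerTailKnQuestion8CoefficientwiseNoCoreAdjPoint
import Summits.CriticalPhenomena.PercolationContinuityZ3.Theorems.PercNearOneGluingNoHeavyLowerTailKnQuestion8CoefficientwiseQmixStarClass
import Summits.CriticalPhenomena.PercolationContinuityZ3.Theorems.PercNearOneGluingNoHeavyLowerTailKnQuestion8CoefficientwisePendantEdge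
import HarnessLib

/-!
# A point ADJACENT TO THE ROOT: `NO-CORE(y)[1_u,g] = 2·(A^{G−e}(u,y)[g] − V^{G−e}(u,y)[g])` for a root edge `e = xu` — prim-lf-2 gen 53 (part 3)

Support file (`--supports stmt-CriticalPhenomena-4575`, closed), prover `prim-lf-2` (gen 53).  No definitions, no named facts, no sorries; standard axioms.
Memo `prim-lf-2/CW-SERIES-gen53.md` §7; parts 1–2: `…CoefficientwiseTwoSourceDomination.lean` (THEOREM A), `…CoefficientwiseSeriesPoint.lean`.

Setting.  Finite multigraph `ends : ι → Sym2 V`, root `x`, `K(s) = openCluster (ends '' s) x`; `NO-CORE(y)[1_u,g] = Σ_{s : ¬(y ∈ K s ∧ y ∈ K sᶜ)} ([u ∈ K s] − [u ∈ K sᶜ])(g(K s) − g(K sᶜ))`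
(CONJECTURE NO-CORE, prim-lf-2 gen 46).  Let `e` be an edge with ends `{u, x}`, `u ≠ x` (the point `u` is ADJACENT TO THE ROOT; `u` may have any further edges).  Resolving the
colour of `e` alone (prim-lf-2 gen 50, CW-TWOSOURCE-gen50 §7, on paper) gives, on `G − e` (edge type `{j // j ∉ {e}}`, clusters `K′ = C_x`, `U′ = C_u`):
* `mem_openCluster_insert_edge_at_root_iff` — `C_x(T ∪ {e}) = C_x(T) ∪ C_u(T)` for EVERY `T` (closed-set principle);
* `noCore_rootEdge_eq` — `NO-CORE(y)[1_u,g] = 2·Σ_{t : ¬(y ∈ K′t ∪ U′t ∧ y ∈ K′tᶜ), u ∉ K′tᶜ} (g(K′t ∪ U′t) − g(K′tᶜ))`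
  (`e` red: `K = K′ ∪ U′ ∋ u`, `K̄ = K̄′`; the `e`-blue class is its swap image — `noCore_split_edge`);
* `noCore_rootEdge_eq_twoSource_sub` — the same written as `2·(A^{G−e}(u,y)[g] − V^{G−e}(u,y)[g])`, where `A` is THEOREM A's two-source exclusion (part 1, `≥ 0` for every
  monotone `g`) and  `V(u,y)[g] := Σ_{t : u ∈ K′tᶜ, ¬(y ∈ K′t ∪ U′t ∧ y ∈ K′tᶜ)} (g(K′t ∪ U′t) − g(K′tᶜ))`;
* `noCore_rootAdj_nonneg_of_claimB` — hence `V^{G−e}(u,y)[g] ≤ 0` implies `NO-CORE(y)[1_u,g] ≥ 0`.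
CLAIM B (prim-lf-2 gen 53): `V(u,y)[g] ≤ 0` for every multigraph, all `u, y` and every monotone `g` ('given that `u` is blue-joined to `x`, the blue cluster of `x` dominates the red cluster
of `{x,u}` outside the core of `y`') — exact census (code/gen53/c/vtest.c, kit53a): 0 exceptions on all graphs with ≤ 6 vertices and ≤ 10 edges (495 260 `(G,u,y)`, min over ALL monotone `g`);
n = 7 and n = 8 (m ≤ 11) running at hand-off (kit j211265–j211308).  CLAIM B would give CONJECTURE NO-CORE for the point `1_u` at EVERY vertex `u` adjacent to the root, of any degree.
[cite: KozmaNitzan2024, Questions 8–9 (§5.5 p. 36) (context: the Question-8 pocket covariance programme)]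
-/

namespace Summit.CriticalPhenomena.PercolationContinuityZ3.Theorems

open Finset Literature.Probability.Percolation

namespace Coefficientwise

variable {ι V : Type*} [Fintype ι] [DecidableEq ι] (ends : ι → Sym2 V) (x : V)

omit [Fintype ι] in
/-- **An edge at the root merges two clusters:** if `e` has ends `{u, x}` then for every `T`, `v ∈ C_x(T ∪ {e}) ↔ v ∈ C_x(T) ∨ v ∈ C_u(T)`.
[cite: KozmaNitzan2024, §5.5 (context only; folklore)] -/
theorem mem_openCluster_insert_edge_at_root_iff (T : Finset ι) {u : V} {e : ι} (he : ends e = s(u, x)) (hxu : x ≠ u) (v : V) :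
    v ∈ openCluster (ends '' (↑(insert e T) : Set ι)) x ↔ (v ∈ openCluster (ends '' (↑T : Set ι)) x ∨ v ∈ openCluster (ends '' (↑T : Set ι)) u) := by
  classical
  constructor
  · intro hv
    set W : Set V := {w | w ∈ openCluster (ends '' (↑T : Set ι)) x ∨ w ∈ openCluster (ends '' (↑T : Set ι)) u} with hW
    have hxW : x ∈ W := Or.inl (mem_openCluster_self _ x)
    have hcl : ∀ a ∈ W, ∀ b, (openGraph (ends '' (↑(insert e T) : Set ι))).Adj a b → b ∈ W := by
      intro a ha b hab
      rw [openGraph_image_adj] at hab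
      obtain ⟨⟨i, hi, hiab⟩, hne⟩ := hab
      rcases Finset.mem_insert.mp hi with rfl | hiT
      · -- the edge `e`: {a,b} = {u,x}
        have hab' : s(a, b) = s(u, x) := by rw [← hiab, he]
        rcases Sym2.eq_iff.mp hab' with ⟨_, hb⟩ | ⟨_, hb⟩
        · rw [hb]; exact Or.inl (mem_openCluster_self _ _)
        · rw [hb]; exact Or.inr (mem_openCluster_self _ _)
      · have hadj : (openGraph (ends '' (↑T : Set ι))).Adj a b := by
          rw [openGraph_image_adj]; exact ⟨⟨i, hiT, hiab⟩, hne⟩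
        rcases ha with ha | ha
        · exact Or.inl (SimpleGraph.Reachable.trans ha hadj.reachable)
        · exact Or.inr (SimpleGraph.Reachable.trans ha hadj.reachable)
    exact openCluster_subset_of_adjClosed ends x (↑(insert e T) : Set ι) W hxW hcl hv
  · intro hv
    have hmono : openCluster (ends '' (↑T : Set ι)) x ⊆ openCluster (ends '' (↑(insert e T) : Set ι)) x :=
      openCluster_image_mono ends (Finset.subset_insert e T) x
    rcases hv with hv | hv
    · exact hmono hv
    · have hxu' : (openGraph (ends '' (↑(insert e T) : Set ι))).Adj x u := by
        rw [openGraph_image_adj]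
        exact ⟨⟨e, Finset.mem_insert_self e T, by rw [he, Sym2.eq_swap]⟩, hxu⟩
      have hv' : v ∈ openCluster (ends '' (↑(insert e T) : Set ι)) u := openCluster_image_mono ends (Finset.subset_insert e T) u hv
      exact SimpleGraph.Reachable.trans hxu'.reachable hv'

section rootEdge

variable {u y : V} {e : ι} (g : Set V → ℝ)

open Classical in
/-- **The root-edge identity (prim-lf-2 gen 50, on paper; here kernel-checked).**  Let `e` have ends `{u, x}`, `u ≠ x`.  Then for every vertex `y` and every `g`,
`NO-CORE(y)[1_u,g] = 2·Σ_{t : ¬(y ∈ K′t ∪ U′t ∧ y ∈ K′tᶜ), u ∉ K′tᶜ} (g(K′t ∪ U′t) − g(K′tᶜ))`, the right side over the cube of `G − e` (edge type `{j // j ∉ {e}}`, `K′ = C_x`,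
`U′ = C_u`).  No hypothesis on the other edges of `u`, none on `g`.  [cite: KozmaNitzan2024, Questions 8–9 (§5.5 p. 36) (context)] -/
theorem noCore_rootEdge_eq (he : ends e = s(u, x)) (hxu : x ≠ u) (y : V) :
    ∑ s ∈ univ.filter (fun s : Finset ι => ¬ (y ∈ openCluster (ends '' (↑s : Set ι)) x ∧ y ∈ openCluster (ends '' (↑(sᶜ) : Set ι)) x)),
      ((if u ∈ openCluster (ends '' (↑s : Set ι)) x then (1 : ℝ) else 0) - (if u ∈ openCluster (ends '' (↑(sᶜ) : Set ι)) x then (1 : ℝ) else 0)) *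
        (g (openCluster (ends '' (↑s : Set ι)) x) - g (openCluster (ends '' (↑(sᶜ) : Set ι)) x)) =
    2 * ∑ t : Finset {j : ι // j ∉ ({e} : Finset ι)},
      (if (¬ (y ∈ openCluster ((fun j : {j : ι // j ∉ ({e} : Finset ι)} => ends j.1) '' (↑t : Set {j : ι // j ∉ ({e} : Finset ι)})) x ∪
                   openCluster ((fun j : {j : ι // j ∉ ({e} : Finset ι)} => ends j.1) '' (↑t : Set {j : ι // j ∉ ({e} : Finset ι)})) u ∧
              y ∈ openCluster ((fun j : {j : ι // j ∉ ({e} : Finset ι)} => ends j.1) '' (↑(tᶜ) : Set {j : ι // j ∉ ({e} : Finset ι)})) x) ∧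
           u ∉ openCluster ((fun j : {j : ι // j ∉ ({e} : Finset ι)} => ends j.1) '' (↑(tᶜ) : Set {j : ι // j ∉ ({e} : Finset ι)})) x) then
        (g (openCluster ((fun j : {j : ι // j ∉ ({e} : Finset ι)} => ends j.1) '' (↑t : Set {j : ι // j ∉ ({e} : Finset ι)})) x ∪
            openCluster ((fun j : {j : ι // j ∉ ({e} : Finset ι)} => ends j.1) '' (↑t : Set {j : ι // j ∉ ({e} : Finset ι)})) u) -
          g (openCluster ((fun j : {j : ι // j ∉ ({e} : Finset ι)} => ends j.1) '' (↑(tᶜ) : Set {j : ι // j ∉ ({e} : Finset ι)})) x))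
      else 0) := by
  classical
  set Pr : ι → Prop := fun j => j ∉ ({e} : Finset ι) with hPr
  set emb := Function.Embedding.subtype Pr with hemb
  set KK : Finset ι → Set V := fun s => openCluster (ends '' (↑s : Set ι)) x with hKK
  set K' : Finset {j : ι // Pr j} → Set V := fun t => openCluster ((fun j : {j : ι // Pr j} => ends j.1) '' (↑t : Set {j : ι // Pr j})) x with hK'
  set U' : Finset {j : ι // Pr j} → Set V := fun t => openCluster ((fun j : {j : ι // Pr j} => ends j.1) '' (↑t : Set {j : ι // Pr j})) u with hU'
  -- split at the edge `e`: NO-CORE = 2 × (the `e`-red half)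
  have h1 := noCore_split_edge ends x y e
    (fun a b => ((if u ∈ a then (1 : ℝ) else 0) - (if u ∈ b then (1 : ℝ) else 0)) * (g a - g b)) (fun a b => by ring)
  beta_reduce at h1
  rw [h1, sum_filter_mem_eq_sum_subcube e]
  congr 1
  refine Finset.sum_congr rfl fun r _ => ?_
  -- sub-cube bookkeeping
  have hKT : ∀ t : Finset {j : ι // Pr j}, K' t = KK (t.map emb) := by
    intro t; simp only [hK', hKK, Finset.coe_map, Set.image_image]; rfl
  have hUT : ∀ t : Finset {j : ι // Pr j}, U' t = openCluster (ends '' (↑(t.map emb) : Set ι)) u := by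
    intro t; simp only [hU', Finset.coe_map, Set.image_image]; rfl
  have hcompl : (r.map emb ∪ {e})ᶜ = rᶜ.map emb := by
    rw [compl_map_union_singleton e r, Finset.sdiff_self, Finset.union_empty]
  have hins : r.map emb ∪ {e} = insert e (r.map emb) := by rw [Finset.union_comm, ← Finset.insert_eq]
  -- the clusters of the two colourings
  have hmem : ∀ v, v ∈ KK (r.map emb ∪ {e}) ↔ v ∈ K' r ∪ U' r := by
    intro v; rw [hins, Set.mem_union, hKT r, hUT r]
    exact mem_openCluster_insert_edge_at_root_iff ends x (r.map emb) he hxu v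
  have hset : KK (r.map emb ∪ {e}) = K' r ∪ U' r := Set.ext hmem
  have hu1 : u ∈ K' r ∪ U' r := Or.inr (mem_openCluster_self _ u)
  have h2 : KK (r.map emb ∪ {e})ᶜ = K' rᶜ := by rw [hcompl, hKT rᶜ]
  change (if ¬ (y ∈ KK (r.map emb ∪ {e}) ∧ y ∈ KK (r.map emb ∪ {e})ᶜ) then
      ((if u ∈ KK (r.map emb ∪ {e}) then (1 : ℝ) else 0) - (if u ∈ KK (r.map emb ∪ {e})ᶜ then (1 : ℝ) else 0)) *
        (g (KK (r.map emb ∪ {e})) - g (KK (r.map emb ∪ {e})ᶜ)) else 0) =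
    (if (¬ (y ∈ K' r ∪ U' r ∧ y ∈ K' rᶜ) ∧ u ∉ K' rᶜ) then (g (K' r ∪ U' r) - g (K' rᶜ)) else 0)
  rw [h2, hset]
  simp only [hu1, if_true]
  by_cases hc : ¬ (y ∈ K' r ∪ U' r ∧ y ∈ K' rᶜ)
  · by_cases hu : u ∈ K' rᶜ
    · have : ¬ (¬ (y ∈ K' r ∪ U' r ∧ y ∈ K' rᶜ) ∧ u ∉ K' rᶜ) := fun h => h.2 hu
      rw [if_pos hc, if_pos hu, if_neg this]; ring
    · rw [if_pos hc, if_neg hu, if_pos ⟨hc, hu⟩]; ring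
  · have : ¬ (¬ (y ∈ K' r ∪ U' r ∧ y ∈ K' rᶜ) ∧ u ∉ K' rᶜ) := fun h => hc h.1
    rw [if_neg hc, if_neg this]

open Classical in
/-- **`NO-CORE(y)[1_u,g] = 2·(A − V)` on `G − e`** for a root edge `e = xu`: `A` = THEOREM A's two-source exclusion `Σ_{¬(y ∈ K′∪U′ ∧ y ∈ K̄′)} (g(K′∪U′) − g(K̄′))` of `G − e` with the second
source `u`, and `V := Σ_{u ∈ K̄′, ¬(y ∈ K′∪U′ ∧ y ∈ K̄′)} (g(K′∪U′) − g(K̄′))` (the colourings in which `u` is blue-joined to `x`).  CLAIM B (prim-lf-2 gen 53, census-clean on ≤ 6 vertices): `V ≤ 0`.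
[cite: KozmaNitzan2024, Questions 8–9 (§5.5 p. 36) (context)] -/
theorem noCore_rootEdge_eq_twoSource_sub (he : ends e = s(u, x)) (hxu : x ≠ u) (y : V) :
    ∑ s ∈ univ.filter (fun s : Finset ι => ¬ (y ∈ openCluster (ends '' (↑s : Set ι)) x ∧ y ∈ openCluster (ends '' (↑(sᶜ) : Set ι)) x)),
      ((if u ∈ openCluster (ends '' (↑s : Set ι)) x then (1 : ℝ) else 0) - (if u ∈ openCluster (ends '' (↑(sᶜ) : Set ι)) x then (1 : ℝ) else 0)) *
        (g (openCluster (ends '' (↑s : Set ι)) x) - g (openCluster (ends '' (↑(sᶜ) : Set ι)) x)) =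
    2 * (∑ t ∈ univ.filter (fun t : Finset {j : ι // j ∉ ({e} : Finset ι)} =>
          ¬ (y ∈ openCluster ((fun j : {j : ι // j ∉ ({e} : Finset ι)} => ends j.1) '' (↑t : Set {j : ι // j ∉ ({e} : Finset ι)})) x ∪
                   openCluster ((fun j : {j : ι // j ∉ ({e} : Finset ι)} => ends j.1) '' (↑t : Set {j : ι // j ∉ ({e} : Finset ι)})) u ∧
               y ∈ openCluster ((fun j : {j : ι // j ∉ ({e} : Finset ι)} => ends j.1) '' (↑(tᶜ) : Set {j : ι // j ∉ ({e} : Finset ι)})) x)),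
          (g (openCluster ((fun j : {j : ι // j ∉ ({e} : Finset ι)} => ends j.1) '' (↑t : Set {j : ι // j ∉ ({e} : Finset ι)})) x ∪
              openCluster ((fun j : {j : ι // j ∉ ({e} : Finset ι)} => ends j.1) '' (↑t : Set {j : ι // j ∉ ({e} : Finset ι)})) u) -
            g (openCluster ((fun j : {j : ι // j ∉ ({e} : Finset ι)} => ends j.1) '' (↑(tᶜ) : Set {j : ι // j ∉ ({e} : Finset ι)})) x))
        - ∑ t ∈ univ.filter (fun t : Finset {j : ι // j ∉ ({e} : Finset ι)} =>
          u ∈ openCluster ((fun j : {j : ι // j ∉ ({e} : Finset ι)} => ends j.1) '' (↑(tᶜ) : Set {j : ι // j ∉ ({e} : Finset ι)})) x ∧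
          ¬ (y ∈ openCluster ((fun j : {j : ι // j ∉ ({e} : Finset ι)} => ends j.1) '' (↑t : Set {j : ι // j ∉ ({e} : Finset ι)})) x ∪
                   openCluster ((fun j : {j : ι // j ∉ ({e} : Finset ι)} => ends j.1) '' (↑t : Set {j : ι // j ∉ ({e} : Finset ι)})) u ∧
               y ∈ openCluster ((fun j : {j : ι // j ∉ ({e} : Finset ι)} => ends j.1) '' (↑(tᶜ) : Set {j : ι // j ∉ ({e} : Finset ι)})) x)),
          (g (openCluster ((fun j : {j : ι // j ∉ ({e} : Finset ι)} => ends j.1) '' (↑t : Set {j : ι // j ∉ ({e} : Finset ι)})) x ∪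
              openCluster ((fun j : {j : ι // j ∉ ({e} : Finset ι)} => ends j.1) '' (↑t : Set {j : ι // j ∉ ({e} : Finset ι)})) u) -
            g (openCluster ((fun j : {j : ι // j ∉ ({e} : Finset ι)} => ends j.1) '' (↑(tᶜ) : Set {j : ι // j ∉ ({e} : Finset ι)})) x))) := by
  classical
  rw [noCore_rootEdge_eq ends x g he hxu y]
  congr 1
  set Pr : ι → Prop := fun j => j ∉ ({e} : Finset ι) with hPr
  set K' : Finset {j : ι // Pr j} → Set V := fun t => openCluster ((fun j : {j : ι // Pr j} => ends j.1) '' (↑t : Set {j : ι // Pr j})) x with hK'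
  set U' : Finset {j : ι // Pr j} → Set V := fun t => openCluster ((fun j : {j : ι // Pr j} => ends j.1) '' (↑t : Set {j : ι // Pr j})) u with hU'
  change ∑ t : Finset {j : ι // Pr j}, (if (¬ (y ∈ K' t ∪ U' t ∧ y ∈ K' tᶜ) ∧ u ∉ K' tᶜ) then (g (K' t ∪ U' t) - g (K' tᶜ)) else 0) =
    ∑ t ∈ univ.filter (fun t : Finset {j : ι // Pr j} => ¬ (y ∈ K' t ∪ U' t ∧ y ∈ K' tᶜ)), (g (K' t ∪ U' t) - g (K' tᶜ))
      - ∑ t ∈ univ.filter (fun t : Finset {j : ι // Pr j} => u ∈ K' tᶜ ∧ ¬ (y ∈ K' t ∪ U' t ∧ y ∈ K' tᶜ)), (g (K' t ∪ U' t) - g (K' tᶜ))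
  rw [Finset.sum_filter, Finset.sum_filter, ← Finset.sum_sub_distrib]
  refine Finset.sum_congr rfl fun t _ => ?_
  by_cases hc : ¬ (y ∈ K' t ∪ U' t ∧ y ∈ K' tᶜ)
  · by_cases hu : u ∈ K' tᶜ
    · have : ¬ (¬ (y ∈ K' t ∪ U' t ∧ y ∈ K' tᶜ) ∧ u ∉ K' tᶜ) := fun h => h.2 hu
      rw [if_neg this, if_pos hc, if_pos ⟨hu, hc⟩]; ring
    · have : ¬ (u ∈ K' tᶜ ∧ ¬ (y ∈ K' t ∪ U' t ∧ y ∈ K' tᶜ)) := fun h => hu h.1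
      rw [if_pos ⟨hc, hu⟩, if_pos hc, if_neg this]; ring
  · have h3 : ¬ (¬ (y ∈ K' t ∪ U' t ∧ y ∈ K' tᶜ) ∧ u ∉ K' tᶜ) := fun h => hc h.1
    have h4 : ¬ (u ∈ K' tᶜ ∧ ¬ (y ∈ K' t ∪ U' t ∧ y ∈ K' tᶜ)) := fun h => hc h.2
    rw [if_neg h3, if_neg hc, if_neg h4]; ring

open Classical in
/-- **CLAIM B implies CONJECTURE NO-CORE at every point adjacent to the root.**  For a root edge `e = xu` (`u ≠ x`), a vertex `y` and a monotone `g`: if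
`V^{G−e}(u,y)[g] := Σ_{u ∈ K̄′, ¬(y ∈ K′∪U′ ∧ y ∈ K̄′)} (g(K′∪U′) − g(K̄′)) ≤ 0`, then `NO-CORE(y)[1_u,g] ≥ 0` — by `noCore_rootEdge_eq_twoSource_sub` and THEOREM A
(`twoSource_noCore_domination`) on `G − e`.  [cite: KozmaNitzan2024, Questions 8–9 (§5.5 p. 36) (context)] -/
theorem noCore_rootAdj_nonneg_of_claimB (he : ends e = s(u, x)) (hxu : x ≠ u) (y : V) (hg : Monotone g)
    (hV : ∑ t ∈ univ.filter (fun t : Finset {j : ι // j ∉ ({e} : Finset ι)} =>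
          u ∈ openCluster ((fun j : {j : ι // j ∉ ({e} : Finset ι)} => ends j.1) '' (↑(tᶜ) : Set {j : ι // j ∉ ({e} : Finset ι)})) x ∧
          ¬ (y ∈ openCluster ((fun j : {j : ι // j ∉ ({e} : Finset ι)} => ends j.1) '' (↑t : Set {j : ι // j ∉ ({e} : Finset ι)})) x ∪
                   openCluster ((fun j : {j : ι // j ∉ ({e} : Finset ι)} => ends j.1) '' (↑t : Set {j : ι // j ∉ ({e} : Finset ι)})) u ∧
               y ∈ openCluster ((fun j : {j : ι // j ∉ ({e} : Finset ι)} => ends j.1) '' (↑(tᶜ) : Set {j : ι // j ∉ ({e} : Finset ι)})) x)),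
          (g (openCluster ((fun j : {j : ι // j ∉ ({e} : Finset ι)} => ends j.1) '' (↑t : Set {j : ι // j ∉ ({e} : Finset ι)})) x ∪
              openCluster ((fun j : {j : ι // j ∉ ({e} : Finset ι)} => ends j.1) '' (↑t : Set {j : ι // j ∉ ({e} : Finset ι)})) u) -
            g (openCluster ((fun j : {j : ι // j ∉ ({e} : Finset ι)} => ends j.1) '' (↑(tᶜ) : Set {j : ι // j ∉ ({e} : Finset ι)})) x)) ≤ 0) :
    0 ≤ ∑ s ∈ univ.filter (fun s : Finset ι => ¬ (y ∈ openCluster (ends '' (↑s : Set ι)) x ∧ y ∈ openCluster (ends '' (↑(sᶜ) : Set ι)) x)),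
      ((if u ∈ openCluster (ends '' (↑s : Set ι)) x then (1 : ℝ) else 0) - (if u ∈ openCluster (ends '' (↑(sᶜ) : Set ι)) x then (1 : ℝ) else 0)) *
        (g (openCluster (ends '' (↑s : Set ι)) x) - g (openCluster (ends '' (↑(sᶜ) : Set ι)) x)) := by
  rw [noCore_rootEdge_eq_twoSource_sub ends x g he hxu y]
  have hA := twoSource_noCore_domination (fun j : {j : ι // j ∉ ({e} : Finset ι)} => ends j.1) x u y g hg
  linarith

end rootEdge

end Coefficientwise

end Summit.CriticalPhenomena.PercolationContinuityZ3.Theorems
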